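/-
Copyright (c) 2026 the pub-hodgecm-mathlib formalisation cell (harness21).  Prover seat hodgecm-mathlib-K2E3-p11 (g10), Track B «K2-LIT», #184♮ = hLiu418 =
`stmt-HodgeConjecture-24832`; socket #41, KIND W, (KW-arch-hBL) — the (L2) letter CLOSED (no sign letters).  THEOREMS ONLY (no `def`, no `instance`, no notation,
no named-fact hypothesis, no `sorry`).
-/
import Summits.HodgeConjecture.HodgeConjecture.Theorems.K2LiuKindWArchGrowthStabUniformSigns   -- ★ (3d-iv) §C (this seat): `stabUniform_posDef ∕ _negDef ∕ _indef` (⊇ ★ p864208 `hWgrU_of_record`)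
import HarnessLib

/-!
# Crux `HLiu418`, socket #41, KIND W — `K2LiuKindWArchGrowthFaceOfRecordClosed`: the (L2) growth-face letter with the three sign inputs discharged

Cell `hodgecm-mathlib`, crux item hLiu418 = `stmt-HodgeConjecture-24832` (helper lane `--supports … --as helper`, count-neutral).  ★ p864208
`K2LiuKindWArchGrowthFaceOfRecord.hWgrU_of_record` (the (L2) letter of K2Liu-p11's (3c) assembler `hBL_of_placeGrowth`) takes three per-sign growth letters
`hPosU ∕ hNegU ∕ hIndU` BY VALUE; ★ (3d-iv) §C `K2LiuKindWArchGrowthStabUniformSigns.{stabUniform_posDef, stabUniform_negDef, stabUniform_indef}` ARE those letters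
(unconditional), up to the binder reshuffle `(hidx, eb, g) := (hidx S h w, eb S h w, Pt S h w)` and the character reading `hebr : eb S h w = e(−tr(hidx S h w ·))`.
This file does the reshuffle once: `hWgrU_of_record_closed` = ★ `hWgrU_of_record` with NO sign letters, binders `(hk : ∀ w, −2 ≤ k w)` and `hebr` added — so (3c)'s
`hBL_of_record` consumes ONE name.  (A sibling, not an edition: ★ §A imports ★ p864208, so ★ p864208 cannot import ★ §C.)
References: [Shimura1997] §16.4, §18.4; [KudlaRallis1994] §1.
HONEST LABEL.  Count-neutral helper, no by-value growth letters left (only `hWhol`, paid by ★ LH4-p10 `hWhol_of_std` at the record); `HC_CM` is proved only modulo the 7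
printed citations (2 remaining named inputs: hLiu418 = `stmt-HodgeConjecture-24832`, h413 = `stmt-HodgeConjecture-24833`) until rung 0 closes.
-/

set_option autoImplicit false
set_option linter.dupNamespace false -- the mandated namespace repeats `HodgeConjecture.HodgeConjecture`

noncomputable section

open Complex Matrix MeasureTheory
open scoped ComplexConjugate ComplexOrder

namespace Summit.HodgeConjecture.HodgeConjecture.Cruxes.HLiu418.K2LiuKindWArchGrowthFaceOfRecordClosed

open Literature.NumberTheory.ModularForms.SiegelUpperHalfSpace (moeb)
open Summit.HodgeConjecture.HodgeConjecture.Cruxes.HLiu418.K2LiuArchInducedTubeDefs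
open Summit.HodgeConjecture.HodgeConjecture.Cruxes.HLiu418.K2LiuU22CompactPictureDefs
open Summit.HodgeConjecture.HodgeConjecture.Cruxes.HLiu418.K2LiuKindWArchGrowthFaceOfRecord (hWgrU_of_record)
open Summit.HodgeConjecture.HodgeConjecture.Cruxes.HLiu418.K2LiuKindWArchGrowthStabUniformSigns (stabUniform_posDef stabUniform_negDef stabUniform_indef)

/-- **THE (L2) GROWTH-FACE LETTER, CLOSED.**  ★ `hWgrU_of_record` with its three sign letters `hPosU ∕ hNegU ∕ hIndU` DISCHARGED by ★ (3d-iv) §C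
(`stabUniform_posDef ∕ stabUniform_negDef ∕ stabUniform_indef` at `(k w, Q w i, B w, C w)`, reshuffled to the datum `(hidx S h w, eb S h w, Pt S h w)` through `hebr`):
binders = ★ `hWgrU_of_record`'s minus the three letters, plus `hk : ∀ w, −2 ≤ k w` and `hebr`; conclusion VERBATIM. [cite: Shimura1997, §16.4, §18.4] [cite: KudlaRallis1994, §1] -/
theorem hWgrU_of_record_closed {ιS ιh W ιQ : Type*} [Fintype W] [Fintype ιQ] (good : ιS → Prop) (k : W → ℤ) (hk : ∀ w, -2 ≤ k w)
    (B C : W → Matrix (Fin 2) (Fin 2) ℂ)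
    (hx : ∀ w, (fromBlocks 0 (B w) (C w) 0 : Matrix (Fin 2 ⊕ Fin 2) (Fin 2 ⊕ Fin 2) ℂ)ᴴ * Matrix.J (Fin 2) ℂ *
      (fromBlocks 0 (B w) (C w) 0 : Matrix (Fin 2 ⊕ Fin 2) (Fin 2 ⊕ Fin 2) ℂ) = Matrix.J (Fin 2) ℂ)
    (Pt : ιS → ιh → W → Matrix (Fin 2 ⊕ Fin 2) (Fin 2 ⊕ Fin 2) ℂ) (hPt : ∀ S h w, (Pt S h w)ᴴ * Matrix.J (Fin 2) ℂ * Pt S h w = Matrix.J (Fin 2) ℂ)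
    (eb : ιS → ιh → W → Matrix (Fin 2) (Fin 2) ℂ → ℂ) (hidx : ιS → ιh → W → Matrix (Fin 2) (Fin 2) ℂ)
    (hherm : ∀ S h w, (hidx S h w)ᴴ = hidx S h w) (hdet : ∀ S, good S → ∀ h w, (hidx S h w).det ≠ 0)
    (hebr : ∀ S h w b, eb S h w b = cexp (-(2 * Real.pi * I) * (hidx S h w * b).trace))
    (Q : W → ιQ → Carrier) (s₁ : ℝ) (hs₁ : 0 ≤ s₁)
    (hWhol : ∀ (S : ιS), good S → ∀ (h : ιh) (w : W) (Q' : Carrier), ∀ s' : ℂ, s₁ < s'.re → ∀ F₀ : Matrix (Fin 2 ⊕ Fin 2) (Fin 2 ⊕ Fin 2) ℂ → ℂ,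
      IsArchSiegelSection (fun z : ℂ => (conj z / ((‖z‖ : ℝ) : ℂ)) ^ (k w)) s' F₀ →
      (∀ (v : Matrix (Fin 2) (Fin 2) ℂ), vᴴ * v = 1 → ∀ hv : v.det ≠ 0,
        F₀ ((2 : ℂ)⁻¹ • fromBlocks (1 + v) (-(I • (1 - v))) (I • (1 - v)) (1 + v) : Matrix (Fin 2 ⊕ Fin 2) (Fin 2 ⊕ Fin 2) ℂ) = evalAt v hv Q') →
      ∃ G : ℂ → Matrix (Fin 2 ⊕ Fin 2) (Fin 2 ⊕ Fin 2) ℂ → ℂ,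
      (∀ s : ℂ, s₁ < s.re → IsArchSiegelSection (fun z : ℂ => (conj z / ((‖z‖ : ℝ) : ℂ)) ^ (k w)) s (G s)) ∧
      (∀ s : ℂ, s₁ < s.re → ∀ (v : Matrix (Fin 2) (Fin 2) ℂ), vᴴ * v = 1 → ∀ hv : v.det ≠ 0,
        G s ((2 : ℂ)⁻¹ • fromBlocks (1 + v) (-(I • (1 - v))) (I • (1 - v)) (1 + v) : Matrix (Fin 2 ⊕ Fin 2) (Fin 2 ⊕ Fin 2) ℂ) = evalAt v hv Q') ∧
      DifferentiableOn ℂ (fun s : ℂ => ∫ r : Fin 2 → Fin 2 → ℝ,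
        G s ((fromBlocks 0 (B w) (C w) 0 : Matrix (Fin 2 ⊕ Fin 2) (Fin 2 ⊕ Fin 2) ℂ) * fromBlocks 1 (hermOfReal r) 0 1 * Pt S h w) * eb S h w (hermOfReal r))
        {s : ℂ | s₁ < s.re})
    :
    ∀ z : ℂ, 0 < z.re → ∃ Cg cg N N' r : ℝ, 0 ≤ Cg ∧ 0 < cg ∧ 0 ≤ N ∧ 0 ≤ N' ∧ 0 < r ∧
      ∀ (w : W) (i : ιQ) (S : ιS), good S → ∀ (h : ιh),
        ∃ Ew : ℂ → ℂ, DifferentiableOn ℂ Ew {s : ℂ | 0 < s.re} ∧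
          (∀ s : ℂ, s₁ < s.re → ∀ F : Matrix (Fin 2 ⊕ Fin 2) (Fin 2 ⊕ Fin 2) ℂ → ℂ, IsArchSiegelSection (fun z : ℂ => (conj z / ((‖z‖ : ℝ) : ℂ)) ^ (k w)) s F →
            (∀ (v : Matrix (Fin 2) (Fin 2) ℂ), vᴴ * v = 1 → ∀ hv : v.det ≠ 0,
              F ((2 : ℂ)⁻¹ • fromBlocks (1 + v) (-(I • (1 - v))) (I • (1 - v)) (1 + v) : Matrix (Fin 2 ⊕ Fin 2) (Fin 2 ⊕ Fin 2) ℂ) = evalAt v hv (Q w i)) →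
            ∫ x : Fin 2 → Fin 2 → ℝ, F ((fromBlocks 0 (B w) (C w) 0 : Matrix (Fin 2 ⊕ Fin 2) (Fin 2 ⊕ Fin 2) ℂ) * fromBlocks 1 (hermOfReal x) 0 1 * Pt S h w) *
              eb S h w (hermOfReal x) = Ew s) ∧
          ∀ s : ℂ, dist s z < r →
            ∀ (X₀ R : Matrix (Fin 2) (Fin 2) ℂ) (u₀ : Matrix (Fin 2 ⊕ Fin 2) (Fin 2 ⊕ Fin 2) ℂ), X₀ᴴ = X₀ → Rᴴ = R → IsUnit R.det →
              u₀ᴴ * Matrix.J (Fin 2) ℂ * u₀ = Matrix.J (Fin 2) ℂ → moeb u₀ (I • (1 : Matrix (Fin 2) (Fin 2) ℂ)) = I • 1 →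
              (fromBlocks (C w) 0 0 (-(B w)) : Matrix (Fin 2 ⊕ Fin 2) (Fin 2 ⊕ Fin 2) ℂ) * Pt S h w = fromBlocks 1 X₀ 0 1 * fromBlocks R 0 0 R⁻¹ * u₀ →
              ‖Ew s‖ ≤ Cg * ‖R.det‖ ^ (2 - 2 * s.re) * Real.exp (-(cg * ∑ a, ∑ b, ‖(R * (((C w)⁻¹)ᴴ * hidx S h w * (C w)⁻¹) * R) a b‖)) *
                (1 + ∑ a, ∑ b, ‖(R * (((C w)⁻¹)ᴴ * hidx S h w * (C w)⁻¹) * R) a b‖) ^ N * (1 + ‖(R * (((C w)⁻¹)ᴴ * hidx S h w * (C w)⁻¹) * R).det‖ ^ (-N')) := by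
  refine hWgrU_of_record good k B C hx Pt hPt eb hidx hherm hdet Q s₁ hs₁ hWhol ?_ ?_ ?_
  · intro z hz w i
    obtain ⟨Cg, cg, N, N', r, h0, h1, h2, h3, h4, H⟩ := stabUniform_posDef (hk w) (Q w i) (hx w) z hz
    exact ⟨Cg, cg, N, N', r, h0, h1, h2, h3, h4, fun S _ h hsg => H (hidx S h w) hsg (eb S h w) (hebr S h w) (Pt S h w) (hPt S h w)⟩
  · intro z hz w i
    obtain ⟨Cg, cg, N, N', r, h0, h1, h2, h3, h4, H⟩ := stabUniform_negDef (hk w) (Q w i) (hx w) z hz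
    exact ⟨Cg, cg, N, N', r, h0, h1, h2, h3, h4, fun S _ h hsg => H (hidx S h w) hsg (eb S h w) (hebr S h w) (Pt S h w) (hPt S h w)⟩
  · intro z hz w i
    obtain ⟨Cg, cg, N, N', r, h0, h1, h2, h3, h4, H⟩ := stabUniform_indef (hk w) (Q w i) (hx w) z hz
    exact ⟨Cg, cg, N, N', r, h0, h1, h2, h3, h4, fun S _ h hsg => H (hidx S h w) ⟨hherm S h w, hsg⟩ (eb S h w) (hebr S h w) (Pt S h w) (hPt S h w)⟩

end Summit.HodgeConjecture.HodgeConjecture.Cruxes.HLiu418.K2LiuKindWArchGrowthFaceOfRecordClosed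

end
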